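import Literature.Analysis.FluidPDE.ESSLocalHolderConcentration
import Literature.Analysis.FluidPDE.LocalTypeIProofs
import HarnessLib

/-!
# ESS Thm. 1.4 (`ess_local_holder`): the blow-up extraction at all levels (ESS 2003, §3,
# (3.13)–(3.16); Seregin 2014, Prop. 6.20 — "for each `a > 0`, `u^{(k)} → u` in `L₃(Q(a))`")

Analysis/FluidPDE proofs-only file (theorems only: no definitions, no named facts), third file
of the bottom-up discharge of `Literature.Analysis.FluidPDE.ess_local_holder` (L. Escauriaza,
G. Seregin, V. Šverák, Russ. Math. Surveys 58:2 (2003) 211–250, Thm. 1.4). The compactness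
theorem for suitable weak solutions available in the tree (`SuitableCompactness_holds`,
Albritton–Barker 2019, Lemma 2.2 after Lin 1998, Thm. 2.2) extracts from a bounded sequence of
suitable pairs on the **unit** parabolic ball a subsequence converging on the balls `Q(R)`,
`R < 1`. The blow-up argument of ESS §3 / G. Seregin, *Lecture Notes on Regularity Theory for
the Navier–Stokes Equations* (2014), Prop. 6.20 needs the rescaled pairs
`u^λ(s, y) = λ v(t₀ + λ² s, x₀ + λ y)`, `p^λ = λ² p ∘ Φ_λ` to converge on **every** `Q(a)`,
`a > 0` ("there exist subsequences … such that, for each `a > 0`, `u^{(k)} → u` in `L₃(Q(a))`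
… and `p^{(k)} ⇀ p` in `L_{3/2}(Q(a))`", Seregin 2014, p. 126). This file performs the
corresponding **diagonal extraction over the levels `a = 2ᵐ`**:

* `exists_diagonal_subsequence` — the abstract diagonal lemma: if at every level `m` every
  strictly increasing index sequence with values `≥ m` has a good subsequence (goodness being
  stable under passing to subsequences), then one strictly increasing `δ` has, for every `m`,
  its shifted tail `k ↦ δ(k + m)` good at level `m`;
* `exists_blowup_levels` — applied to the base scales `λₙ = 2^{-(n+2)}` and the zoom-outs by
  `2ᵐ` of the rescaled family of `ESSLocalHolderConcentration.lean` (which at level `m` are the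
  rescaled pairs at the scales `2ᵐ λₙ ≤ 1/4`, suitable on the unit ball with the uniform
  `L³ × L^{3/2}` bound `eLpNorm_zoom_add_le`): there are a strictly increasing `δ` (`δ(k) ≥ k`)
  and, for every level `m`, a suitable pair `(u_m, q_m)` on the balls `Q(R)`, `R < 1`, with
  `u_m ∈ L³(Q(R))`, such that along `j ↦ δ(j + m)` the pairs rescaled at the scales
  `2ᵐ λ_{δ(j+m)}` converge to `(u_m, q_m)` — velocities strongly in `L³(Q(R))`, pressures weakly
  in `L^{3/2}(Q(R))` (tested against `L³(Q(R))`).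

The identification of the levels with one local energy ancient solution on `ℝ³ × ]-∞, 0[`
(scale covariance of the zoom, uniqueness of `L³`/weak limits, gluing) is carried out in the
sequel file.

Nothing accepted is restated or changed; no `sorry`.

## References

* L. Escauriaza, G. Seregin, V. Šverák, Russ. Math. Surveys 58:2 (2003) 211–250: §3,
  (3.13)–(3.16). [`EscauriazaSereginSverak2003`]
* G. Seregin, *Lecture Notes on Regularity Theory for the Navier–Stokes Equations*, World
  Scientific (2014), §6.6, Prop. 6.20, p. 126. [`Seregin2014`]
* D. Albritton, T. Barker, J. Math. Fluid Mech. 21 (2019), Lemma 2.2; F.-H. Lin, Comm. Pure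
  Appl. Math. 51 (1998), Thm. 2.2. [`AlbrittonBarker2019`]
-/

noncomputable section

open MeasureTheory Set Function Filter Topology TopologicalSpace Metric
open scoped NNReal ENNReal

namespace Literature.Analysis.FluidPDE

/-! ### The abstract diagonal lemma -/

/-- **Diagonal extraction.** Let `Good m ρ d` ("along the index sequence `ρ` the level-`m`
objects converge to `d`") be stable under passing to subsequences, and suppose that at every
level `m` every strictly increasing `τ : ℕ → ℕ` with values `≥ m` admits a strictly increasing
`σ` and data `d` with `Good m (τ ∘ σ) d`. Then there is one strictly increasing `δ` with
`δ(k) ≥ k` such that for every `m` the shifted tail `k ↦ δ(k + m)` is good at level `m`.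
(Nested extractions `τ_{m+1} = (τ_m ∘ (· + (m+1))) ∘ σ_{m+1}`, diagonal `δ(k) = τ_k(k)`; the
tail of the diagonal from `m` on is a subsequence of `τ_m`.) [folklore] -/
theorem exists_diagonal_subsequence {D : Type*} (Good : ℕ → (ℕ → ℕ) → D → Prop)
    (hsub : ∀ (m : ℕ) (ρ : ℕ → ℕ) (d : D) (φ : ℕ → ℕ),
      Good m ρ d → StrictMono φ → Good m (ρ ∘ φ) d)
    (hstep : ∀ (m : ℕ) (τ : ℕ → ℕ), StrictMono τ → (∀ k, m ≤ τ k) →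
      ∃ σ : ℕ → ℕ, StrictMono σ ∧ ∃ d : D, Good m (τ ∘ σ) d) :
    ∃ δ : ℕ → ℕ, StrictMono δ ∧ (∀ k, k ≤ δ k) ∧
      ∀ m : ℕ, ∃ d : D, Good m (fun k => δ (k + m)) d := by
  classical
  -- ## the extraction operator on strictly increasing sequences
  have hstep' : ∀ (m : ℕ) (τ : {τ : ℕ → ℕ // StrictMono τ}),
      ∃ σ : {σ : ℕ → ℕ // StrictMono σ}, ∃ d : D,
        Good m ((τ.1 ∘ fun k => k + m) ∘ σ.1) d := by
    intro m τ
    have hτ' : StrictMono (τ.1 ∘ fun k => k + m) :=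
      τ.2.comp (strictMono_id.add_const m)
    have hval : ∀ k, m ≤ (τ.1 ∘ fun k => k + m) k := fun k =>
      le_trans (Nat.le_add_left m k) (τ.2.id_le (k + m))
    obtain ⟨σ, hσ, d, hd⟩ := hstep m _ hτ' hval
    exact ⟨⟨σ, hσ⟩, d, hd⟩
  choose Sg hSg using hstep'
  -- ## the tower of nested subsequences
  set next : ℕ → {τ : ℕ → ℕ // StrictMono τ} → {τ : ℕ → ℕ // StrictMono τ} :=
    fun m τ => ⟨(τ.1 ∘ fun k => k + m) ∘ (Sg m τ).1,
      (τ.2.comp (strictMono_id.add_const m)).comp (Sg m τ).2⟩ with hnext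
  set T : ℕ → {τ : ℕ → ℕ // StrictMono τ} := fun m =>
    Nat.rec (motive := fun _ => {τ : ℕ → ℕ // StrictMono τ}) (next 0 ⟨id, strictMono_id⟩)
      (fun m τm => next (m + 1) τm) m with hT
  have hT0 : T 0 = next 0 ⟨id, strictMono_id⟩ := rfl
  have hTsucc : ∀ m, T (m + 1) = next (m + 1) (T m) := fun m => rfl
  -- goodness at every level
  have hgoodT : ∀ m, ∃ d : D, Good m (T m).1 d := by
    intro m
    cases m with
    | zero => rw [hT0]; exact hSg 0 ⟨id, strictMono_id⟩
    | succ m => rw [hTsucc]; exact hSg (m + 1) (T m)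
  -- the values of `next m τ` are values of `τ` beyond `m`
  have hnext_apply : ∀ m (τ : {τ : ℕ → ℕ // StrictMono τ}) k,
      (next m τ).1 k = τ.1 ((Sg m τ).1 k + m) := fun m τ k => rfl
  -- ## the diagonal
  set δ : ℕ → ℕ := fun k => (T k).1 k with hδ
  have hδmono : StrictMono δ := by
    refine strictMono_nat_of_lt_succ fun k => ?_
    show (T k).1 k < (T (k + 1)).1 (k + 1)
    rw [hTsucc, hnext_apply]
    exact (T k).2 (by have := ((Sg (k + 1) (T k)).2.id_le (k + 1)); omega)
  have hδge : ∀ k, k ≤ δ k := fun k => (T k).2.id_le k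
  refine ⟨δ, hδmono, hδge, fun m => ?_⟩
  -- ## the tail from `m` on is a subsequence of `T m`
  have htower : ∀ i : ℕ, ∃ χ : ℕ → ℕ, StrictMono χ ∧ (T (m + i)).1 = (T m).1 ∘ χ := by
    intro i
    induction i with
    | zero => exact ⟨id, strictMono_id, rfl⟩
    | succ i ih =>
        obtain ⟨χ, hχ, hχe⟩ := ih
        refine ⟨(χ ∘ fun k => k + (m + i + 1)) ∘ (Sg (m + i + 1) (T (m + i))).1,
          (hχ.comp (strictMono_id.add_const _)).comp (Sg (m + i + 1) (T (m + i))).2, ?_⟩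
        rw [show m + (i + 1) = m + i + 1 by ring, hTsucc]
        funext k
        rw [hnext_apply]
        show (T (m + i)).1 _ = _
        rw [hχe]
        rfl
  choose χ hχ hχe using htower
  set ψ : ℕ → ℕ := fun k => χ k (k + m) with hψ
  have hψδ : ∀ k, δ (k + m) = (T m).1 (ψ k) := by
    intro k
    show (T (k + m)).1 (k + m) = (T m).1 (χ k (k + m))
    rw [add_comm k m, show (T (m + k)).1 = (T m).1 ∘ χ k from hχe k]
    rfl
  have hψmono : StrictMono ψ := by
    refine strictMono_nat_of_lt_succ fun k => ?_
    have h1 : δ (k + m) < δ (k + 1 + m) := hδmono (by omega)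
    rw [hψδ, hψδ] at h1
    exact (T m).2.lt_iff_lt.1 h1
  obtain ⟨d, hd⟩ := hgoodT m
  refine ⟨d, ?_⟩
  have e : (fun k => δ (k + m)) = (T m).1 ∘ ψ := funext fun k => hψδ k
  rw [e]
  exact hsub m _ d ψ hd hψmono


/-! ### The scales `2ᵐ λₙ`, `λₙ = 2^{-(n+2)}` -/

/-- The scale of level `m` at base index `n ≥ m` is at most `1/4 ≤ 1/2`:
`2ᵐ (1/2)^{n+2} = (1/2)^{n+2-m}`. [folklore] -/
theorem level_scale_le_half {m n : ℕ} (hmn : m ≤ n) :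
    (2 : ℝ) ^ m * (1 / 2) ^ (n + 2) ≤ 1 / 2 := by
  have e : (2 : ℝ) ^ m * (1 / 2) ^ (n + 2) = (1 / 2) ^ (n + 2 - m) := by
    rw [show n + 2 = m + (n + 2 - m) by omega, pow_add, ← mul_assoc, ← mul_pow]
    norm_num
  rw [e]
  calc (1 / 2 : ℝ) ^ (n + 2 - m) ≤ (1 / 2) ^ 1 :=
        pow_le_pow_of_le_one (by norm_num) (by norm_num) (by omega)
    _ = 1 / 2 := by norm_num

/-- The scales are positive. [folklore] -/
theorem level_scale_pos (m n : ℕ) : (0 : ℝ) < (2 : ℝ) ^ m * (1 / 2) ^ (n + 2) := by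
  positivity

/-! ### The extraction at all levels -/

section Levels

variable {v : ℝ → EuclideanSpace ℝ (Fin 3) → EuclideanSpace ℝ (Fin 3)}
  {p : ℝ → EuclideanSpace ℝ (Fin 3) → ℝ}

/-- **The blow-up extraction at all levels** (ESS 2003, §3 (3.13)–(3.16); Seregin 2014,
Prop. 6.20: "there exist subsequences of `u^{(k)}` and `p^{(k)}` … such that, for each `a > 0`,
`u^{(k)} → u` in `L₃(Q(a))` … and `p^{(k)} ⇀ p` in `L_{3/2}(Q(a))`"). Let `(v, p)` satisfy
(1.15)–(1.16) on `Q(1)` and `z₀ ∈ Q̄(1/2)`. With the base scales `λₙ = 2^{-(n+2)}` there are a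
strictly increasing `δ : ℕ → ℕ`, `δ(k) ≥ k`, and for every level `m` a pair `(u_m, q_m)`,
suitable on every `Q(R)`, `0 < R < 1`, with `u_m ∈ L³(Q(R))`, such that along `j ↦ δ(j + m)`
the rescaled pairs at the scales `2ᵐ λ_{δ(j+m)}` (the zoom-outs by `2ᵐ` of the rescaled pairs
at the scales `λ_{δ(j+m)}`) converge to `(u_m, q_m)`: velocities strongly in `L³(Q(R))`,
pressures weakly in `L^{3/2}(Q(R))`. Proof: the compactness theorem `SuitableCompactness_holds`
at each level (the rescaled family is suitable on the unit ball with the uniform bound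
`eLpNorm_zoom_add_le`), and the diagonal lemma `exists_diagonal_subsequence`. [cite: EscauriazaSereginSverak2003, §3 (3.13)–(3.16)] [cite: Seregin2014, §6.6 Prop. 6.20] -/
theorem exists_blowup_levels
    (h : IsL3inftyLocalPair 1 1 ((0 : ℝ), (0 : EuclideanSpace ℝ (Fin 3))) v p)
    {z₀ : ℝ × EuclideanSpace ℝ (Fin 3)}
    (hz₀ : z₀ ∈ closure (parabolicCylinder (1 / 2) ((0 : ℝ), (0 : EuclideanSpace ℝ (Fin 3))))) :
    ∃ δ : ℕ → ℕ, StrictMono δ ∧ (∀ k, k ≤ δ k) ∧ ∀ m : ℕ,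
      ∃ (u : ℝ → EuclideanSpace ℝ (Fin 3) → EuclideanSpace ℝ (Fin 3))
        (q : ℝ → EuclideanSpace ℝ (Fin 3) → ℝ), ∀ R ∈ Ioo (0 : ℝ) 1,
        IsSuitableWeakSolutionInBall R 0 u q ∧
        MemLp (uncurry u) 3
          (volume.restrict (parabolicCylinder R (0 : ℝ × EuclideanSpace ℝ (Fin 3)))) ∧
        Tendsto (fun j => eLpNorm
            (uncurry (((2 : ℝ) ^ m * (1 / 2) ^ (δ (j + m) + 2)) •
                stPull (((2 : ℝ) ^ m * (1 / 2) ^ (δ (j + m) + 2)) ^ 2)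
                  ((2 : ℝ) ^ m * (1 / 2) ^ (δ (j + m) + 2)) z₀.1 z₀.2 v) - uncurry u) 3
            (volume.restrict (parabolicCylinder R (0 : ℝ × EuclideanSpace ℝ (Fin 3)))))
          atTop (𝓝 0) ∧
        ∀ g : ℝ × EuclideanSpace ℝ (Fin 3) → ℝ,
          MemLp g 3 (volume.restrict (parabolicCylinder R (0 : ℝ × EuclideanSpace ℝ (Fin 3)))) →
          Tendsto (fun j => ∫ w in parabolicCylinder R (0 : ℝ × EuclideanSpace ℝ (Fin 3)),
              (((2 : ℝ) ^ m * (1 / 2) ^ (δ (j + m) + 2)) ^ 2 •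
                stPull (((2 : ℝ) ^ m * (1 / 2) ^ (δ (j + m) + 2)) ^ 2)
                  ((2 : ℝ) ^ m * (1 / 2) ^ (δ (j + m) + 2)) z₀.1 z₀.2 p) w.1 w.2 * g w)
            atTop (𝓝 (∫ w in parabolicCylinder R (0 : ℝ × EuclideanSpace ℝ (Fin 3)),
              q w.1 w.2 * g w)) := by
  obtain ⟨M, hM⟩ := exists_cknC_le h
  obtain ⟨D, hD⟩ := exists_cknD_le h hz₀
  -- ## abbreviations: scales, zooms, the cylinders' measures, goodness
  set sc : ℕ → ℕ → ℝ := fun m n => (2 : ℝ) ^ m * (1 / 2) ^ (n + 2) with hsc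
  set Uz : ℝ → ℝ → EuclideanSpace ℝ (Fin 3) → EuclideanSpace ℝ (Fin 3) :=
    fun r => r • stPull (r ^ 2) r z₀.1 z₀.2 v with hUz
  set Pz : ℝ → ℝ → EuclideanSpace ℝ (Fin 3) → ℝ :=
    fun r => r ^ 2 • stPull (r ^ 2) r z₀.1 z₀.2 p with hPz
  set μ : ℝ → Measure (ℝ × EuclideanSpace ℝ (Fin 3)) :=
    fun R => volume.restrict (parabolicCylinder R (0 : ℝ × EuclideanSpace ℝ (Fin 3))) with hμ
  set Good : ℕ → (ℕ → ℕ) →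
      ((ℝ → EuclideanSpace ℝ (Fin 3) → EuclideanSpace ℝ (Fin 3)) ×
        (ℝ → EuclideanSpace ℝ (Fin 3) → ℝ)) → Prop :=
    fun m ρ d => ∀ R ∈ Ioo (0 : ℝ) 1,
      IsSuitableWeakSolutionInBall R 0 d.1 d.2 ∧ MemLp (uncurry d.1) 3 (μ R) ∧
      Tendsto (fun j => eLpNorm (uncurry (Uz (sc m (ρ j))) - uncurry d.1) 3 (μ R)) atTop (𝓝 0) ∧
      ∀ g : ℝ × EuclideanSpace ℝ (Fin 3) → ℝ, MemLp g 3 (μ R) →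
        Tendsto (fun j => ∫ w in parabolicCylinder R (0 : ℝ × EuclideanSpace ℝ (Fin 3)),
            (Pz (sc m (ρ j))) w.1 w.2 * g w) atTop
          (𝓝 (∫ w in parabolicCylinder R (0 : ℝ × EuclideanSpace ℝ (Fin 3)), d.2 w.1 w.2 * g w))
    with hGood
  -- ## goodness is stable under subsequences
  have hsub : ∀ (m : ℕ) (ρ : ℕ → ℕ) d (φ : ℕ → ℕ), Good m ρ d → StrictMono φ →
      Good m (ρ ∘ φ) d := by
    intro m ρ d φ hg hφ R hR
    obtain ⟨h1, h2, h3, h4⟩ := hg R hR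
    exact ⟨h1, h2, h3.comp hφ.tendsto_atTop, fun g hg' => (h4 g hg').comp hφ.tendsto_atTop⟩
  -- ## extraction at one level (the compactness theorem)
  have hstep : ∀ (m : ℕ) (τ : ℕ → ℕ), StrictMono τ → (∀ k, m ≤ τ k) →
      ∃ σ : ℕ → ℕ, StrictMono σ ∧ ∃ d, Good m (τ ∘ σ) d := by
    intro m τ hτ hval
    have hscale : ∀ k, sc m (τ k) ∈ Ioc (0 : ℝ) (1 / 2) := fun k =>
      ⟨level_scale_pos m (τ k), level_scale_le_half (hval k)⟩
    have hsuit : ∀ k, IsSuitableWeakSolutionInBall 1 0 (Uz (sc m (τ k))) (Pz (sc m (τ k))) :=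
      fun k => zoom_isSuitableWeakSolutionInBall h hz₀ (hscale k)
    have hbound : (⨆ k, eLpNorm (uncurry (Uz (sc m (τ k)))) 3 (μ 1) +
        eLpNorm (uncurry (Pz (sc m (τ k)))) (3 / 2) (μ 1)) < ∞ := by
      refine lt_of_le_of_lt (iSup_le fun k => eLpNorm_zoom_add_le hM hz₀ hD (hscale k)) ?_
      exact ENNReal.add_lt_top.2
        ⟨ENNReal.rpow_lt_top_of_nonneg (by norm_num) ENNReal.coe_ne_top,
          ENNReal.rpow_lt_top_of_nonneg (by norm_num) ENNReal.coe_ne_top⟩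
    obtain ⟨u, q, σ, hσ, hconv⟩ :=
      SuitableCompactness_holds (fun k => Uz (sc m (τ k))) (fun k => Pz (sc m (τ k))) hsuit hbound
    exact ⟨σ, hσ, (u, q), fun R hR => hconv R hR⟩
  -- ## the diagonal
  obtain ⟨δ, hδ, hδge, hgood⟩ := exists_diagonal_subsequence Good hsub hstep
  refine ⟨δ, hδ, hδge, fun m => ?_⟩
  obtain ⟨⟨u, q⟩, hd⟩ := hgood m
  exact ⟨u, q, fun R hR => hd R hR⟩

end Levels

end Literature.Analysis.FluidPDE
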